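import Summits.Ventures.CertifiedArithmetic.Expansions.IncircleStageBExpansion
import Summits.Ventures.CertifiedArithmetic.Expansions.IncircleStageBBounds
import Summits.Ventures.CertifiedArithmetic.Expansions.IncircleStageBMargins
import Literature.ComputerArithmetic.Shewchuk1997.IncircleStageA
import Mathlib.Tactic.Linarith
import Mathlib.Tactic.Positivity
import Mathlib.Tactic.Ring
import Mathlib.Tactic.NormNum

/-!
# Stage B of INCIRCLE, the assembly: the stage-B test of `incircleadapt` is sound

NEW WORK in the sense of this development (algorithm: Shewchuk, `predicates.c` `incircleadapt` and
Table 5; the model over `ℚ`, the statement of correctness and its proof are ours; nothing here is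
cited anywhere as a literature fact; the coefficient certified is OURS, `(4 + 56ε)ε`, not the
table's `(4 + 48ε)ε` — see `IncircleStageBMargins.lean` for why and for what that does NOT claim).
Twin of `Orient3dStageB.lean` (ORIENT3D).

THE MODEL (`incircleStageB`).  After the stage-A filter (`incircleStageA`,
`Literature/…/Shewchuk1997/IncircleStageA.lean`) falls through, `incircleadapt` forms the six
differences `adx = a_x ⊖ d_x, …, cdy = c_y ⊖ d_y`, the exact expansion `fin1` of the incircle
determinant of these COMPUTED differences (`incircleB`, `IncircleStageBExpansion.lean`: a nonempty
W-expansion of ≤ 96 floats with sum `B = incircleDetB`), `det = estimate(fin1)`,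
`errbound = K ⊗ permanent` with the `permanent` inherited from stage A (`incirclePermanent`, the
same floating-point expression as in `incircleStageA`), and returns `det` iff `det ≥ errbound` or
`−det ≥ errbound`; otherwise it goes on to stages C–D.  Exact model over `ℚ`, an abstract
round-to-nearest `fl` into `F(p, emin)`, an abstract two-product `tp`, no overflow.

THE RESULT, relative to ONE explicit hypothesis on `estimate` (`hest3`): the relative error bound
of Shewchuk's `estimate` on W-expansions of floats of `F(p, emin)`, `|estimate(e) − Σe| ≤ 3ε|Σe|`
— exactly the conclusion of `abs_estimate_sub_sum_le_of_isWeakExpansion`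
(`EstimateRelativeError.lean`, this library, in review at the time of writing; every
round-to-nearest, `p ≥ 2`).  It is a HYPOTHESIS of each theorem here, never a fact; the
unconditional corollaries are one-liners once that file is in the tree.
* **`incircleStageB_correct_of_estimate`** — for `p ≥ 6`, `fl` a round-to-nearest with the
  `RoundoffBelow 2` property (e.g. ties-to-even) satisfying the `estimate` bound,
  `K = iccerrboundB56 p = (4 + 56ε)ε`, the eight coordinates in a format `F(p, e₀)` with
  `emin ≤ e₀` and `emin + 2p ≤ 4e₀` (stage A's hypotheses: every rounding of the permanent chain is
  exact or of a normal number; they also give `2e₀, 3e₀, 4e₀ ≥ emin`, no partial product of the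
  expansion underflows), and `tp` error-free on `F(p, e₀)²`, `F(p, 2e₀) × F(p, e₀)` and
  `F(p, 3e₀) × F(p, e₀)`: **if stage B returns `d`, then `d > 0 ↔ (9) > 0` and `d < 0 ↔ (9) < 0`**
  for the exact determinant `incircleDet` of the input points — `d ≠ 0` and the returned sign is the
  true incircle answer.
  Proof = the landed ingredients and nothing else: `incircleB_spec` (`fin1` is a W-expansion of
  floats with `Σ = B`), the hypothesis (`|det − B| ≤ 3ε|B|`), the margin `iccerrboundB56_margin`
  (`(1 + 3ε)(4ε + 18ε² + 34ε³ + 35ε⁴ + 21ε⁵ + 7ε⁶ + ε⁷) < (1 − ε)⁵K` for `ε ≤ 1/64`,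
  `IncircleStageBMargins.lean`) and the rational analysis `incircle_stageB_sign_of_bounds`
  (`IncircleStageBBounds.lean`) fed with the roundoff facts of the floating-point operations (the
  grids `2^e₀ ℤ`, `2^2e₀ ℤ`, `2^4e₀ ℤ`, `2^(4e₀ − 2p) ℤ` and the signs of the computed squares and
  lifts, exactly as in the stage-A proof `incircleStageA_correct`).
* `incircleStageB_fma_correct_of_estimate` / `incircleStageB_dekker_correct_of_estimate` — the
  two-product hypotheses discharged for the FMA two-product, and for Dekker's TWO-PRODUCT with
  `predicates.c`'s splitter (`p ≤ 2s ≤ p + 1`, rounding odd, `e₀ ≥ emin + p − 1`,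
  `2e₀ ≥ emin + 2p − 1` and stage A's `4e₀ ≥ emin + 2p`, which give `3e₀, 4e₀ ≥ emin + 2p − 1`).
* The coefficient is representable: `isFloat_iccerrboundB56` (`IncircleStageBMargins.lean`;
  `p ≥ 4`, `emin ≤ 3 − 2p`), so `K ⊗ permanent` is the product the C code forms.
* `incircleStageA_eq` — stage A reads the same `permanent` (by `rfl`).

WHAT THIS DOES NOT SAY.  The `estimate` bound is assumed, not proved, in THIS file.  Nothing about
stage A having failed is used; nothing is claimed about `predicates.c` with ITS constant
`(4 + 48ε)ε` (our margin does not certify it with the estimate error `3ε` available to us —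
recorded in `IncircleStageBMargins.lean`, not adjudicated); stages C–D of INCIRCLE are not treated.
HONEST CAVEATS: overflow is not modelled; for binary64 (`p = 53`, `emin = −1074`) the format
hypothesis `emin + 2p ≤ 4e₀` means coordinates that are multiples of `2^−242`, not arbitrary
doubles.  No separate numerical evidence was gathered for this file (it composes proved
statements; the ingredients came with their own evidence).

References: J. R. Shewchuk, Discrete Comput. Geom. 18 (1997) 305–363, §4.4 (Table 5) and
`predicates.c` (`incircle`, `incircleadapt`) [Shewchuk1997].
-/

namespace Summit.Ventures.CertifiedArithmetic.Expansions

open Literature.ComputerArithmetic.JeannerodRump2018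
open Literature.ComputerArithmetic.BoldoJeannerodMelquiondMuller2023 hiding twoSum twoSum_fst
  isFloat_twoSum
open Literature.ComputerArithmetic.Shewchuk1997

variable {p : ℕ} {emin : ℤ} {fl : ℚ → ℚ}

/-! ## The model of stage B -/

/-- The `permanent` of INCIRCLE's stage A (Table 5; `predicates.c` `incircle`), passed on to
`incircleadapt`: `(|bdxcdy| ⊕ |cdxbdy|) ⊗ alift ⊕ (|cdxady| ⊕ |adxcdy|) ⊗ blift
⊕ (|adxbdy| ⊕ |bdxady|) ⊗ clift` (left to right), `alift = adx ⊗ adx ⊕ ady ⊗ ady`, … —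
literally the expression inside `incircleStageA`. -/
def incirclePermanent (fl : ℚ → ℚ) (a₁ a₂ b₁ b₂ c₁ c₂ d₁ d₂ : ℚ) : ℚ :=
  let adx := fl (a₁ - d₁)
  let bdx := fl (b₁ - d₁)
  let cdx := fl (c₁ - d₁)
  let ady := fl (a₂ - d₂)
  let bdy := fl (b₂ - d₂)
  let cdy := fl (c₂ - d₂)
  let bdxcdy := fl (bdx * cdy)
  let cdxbdy := fl (cdx * bdy)
  let alift := fl (fl (adx * adx) + fl (ady * ady))
  let cdxady := fl (cdx * ady)
  let adxcdy := fl (adx * cdy)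
  let blift := fl (fl (bdx * bdx) + fl (bdy * bdy))
  let adxbdy := fl (adx * bdy)
  let bdxady := fl (bdx * ady)
  let clift := fl (fl (cdx * cdx) + fl (cdy * cdy))
  fl (fl (fl (fl (|bdxcdy| + |cdxbdy|) * alift) + fl (fl (|cdxady| + |adxcdy|) * blift))
    + fl (fl (|adxbdy| + |bdxady|) * clift))

/-- **Stage B of `incircleadapt`** over a two-product `tp`, a rounding `fl`, a coefficient `K` and
the inherited `permanent`: `fin1 ⇐ incircleB(adx, ady, bdx, bdy, cdx, cdy)` (the exact expansion
of the incircle determinant of the computed differences), `det ⇐ estimate(fin1)`,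
`errbound ⇐ K ⊗ permanent`; return `det` iff `det ≥ errbound` or `−det ≥ errbound`.
`some det` = stage B answers; `none` = fall through to stage C. -/
def incircleStageB (tp : ℚ → ℚ → ℚ × ℚ) (fl : ℚ → ℚ) (K permanent : ℚ)
    (a₁ a₂ b₁ b₂ c₁ c₂ d₁ d₂ : ℚ) : Option ℚ :=
  let det := estimate fl (incircleB tp fl (fl (a₁ - d₁)) (fl (a₂ - d₂)) (fl (b₁ - d₁))
    (fl (b₂ - d₂)) (fl (c₁ - d₁)) (fl (c₂ - d₂)))
  if fl (K * permanent) ≤ det ∨ fl (K * permanent) ≤ -det then some det else none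

/-! ## The stage-B test is sound -/

/-- **THE STAGE-B TEST OF `incircleadapt` IS SOUND with `K = (4 + 56ε)ε`, given the `estimate`
bound.**  Let `p ≥ 6`, `fl` any round-to-nearest into `F(p, emin)` with the `RoundoffBelow 2`
property (e.g. ties-to-even) whose `estimate` is `3ε`-accurate on W-expansions of floats (`hest3`,
the conclusion of `abs_estimate_sub_sum_le_of_isWeakExpansion`), the eight coordinates floats of a
format `F(p, e₀)` with `emin ≤ e₀` and `emin + 2p ≤ 4e₀`, and the two-product routine error-free
on `F(p, e₀)²`, `F(p, 2e₀) × F(p, e₀)` and `F(p, 3e₀) × F(p, e₀)`.  If stage B, run with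
`K = iccerrboundB56 p` and the permanent of stage A, returns `d`, then `d > 0 ↔ (9) > 0` and
`d < 0 ↔ (9) < 0` for the exact determinant `incircleDet`; in particular `d ≠ 0` and the returned
sign is the true incircle answer. -/
theorem incircleStageB_correct_of_estimate (hp : 6 ≤ p) (hfl : IsRoundNearest p emin fl)
    (hfl2 : RoundoffBelow 2 fl)
    (hest3 : ∀ ⦃l : List ℚ⦄, (∀ x ∈ l, IsFloat p emin x) → IsWeakExpansion l →
      |estimate fl l - l.sum| ≤ 3 * unitRoundoff p * |l.sum|)
    {e₀ : ℤ} (he₀ : emin ≤ e₀) (h4 : emin + 2 * p ≤ e₀ + e₀ + e₀ + e₀)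
    {a₁ a₂ b₁ b₂ c₁ c₂ d₁ d₂ : ℚ}
    (ha₁ : IsFloat p e₀ a₁) (ha₂ : IsFloat p e₀ a₂) (hb₁ : IsFloat p e₀ b₁)
    (hb₂ : IsFloat p e₀ b₂) (hc₁ : IsFloat p e₀ c₁) (hc₂ : IsFloat p e₀ c₂)
    (hd₁ : IsFloat p e₀ d₁) (hd₂ : IsFloat p e₀ d₂)
    {tp : ℚ → ℚ → ℚ × ℚ}
    (htp : ∀ x y, IsFloat p e₀ x → IsFloat p e₀ y → ExactTwoProd p emin fl tp x y)
    (htp' : ∀ x y, IsFloat p (e₀ + e₀) x → IsFloat p e₀ y → ExactTwoProd p emin fl tp x y)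
    (htp'' : ∀ x y, IsFloat p (e₀ + e₀ + e₀) x → IsFloat p e₀ y → ExactTwoProd p emin fl tp x y)
    {d : ℚ}
    (hB : incircleStageB tp fl (iccerrboundB56 p) (incirclePermanent fl a₁ a₂ b₁ b₂ c₁ c₂ d₁ d₂)
      a₁ a₂ b₁ b₂ c₁ c₂ d₁ d₂ = some d) :
    (0 < d ↔ 0 < incircleDet a₁ a₂ b₁ b₂ c₁ c₂ d₁ d₂) ∧
      (d < 0 ↔ incircleDet a₁ a₂ b₁ b₂ c₁ c₂ d₁ d₂ < 0) := by
  have hp1 : 1 ≤ p := le_trans (by norm_num) hp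
  have hp4 : 4 ≤ p := le_trans (by norm_num) hp
  have he₂ : emin ≤ e₀ + e₀ := by omega
  have he₃ : emin ≤ e₀ + e₀ + e₀ := by omega
  have he₄' : emin ≤ e₀ + e₀ + e₀ + e₀ := by omega
  have he₄ : emin ≤ e₀ + e₀ + (e₀ + e₀) := by omega
  have he₅ : emin ≤ -(2 * (p : ℤ)) + (e₀ + e₀ + (e₀ + e₀)) := by omega
  have hu0 : 0 < unitRoundoff p := by unfold unitRoundoff; positivity
  have hu64 : unitRoundoff p ≤ 1 / 64 := by
    unfold unitRoundoff
    have h : (64 : ℚ) ≤ 2 ^ p := by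
      calc (64 : ℚ) = 2 ^ 6 := by norm_num
        _ ≤ 2 ^ p := pow_le_pow_right₀ (by norm_num) hp
    exact one_div_le_one_div_of_le (by norm_num) h
  have hu2 : unitRoundoff p ≤ 1 / 2 := by linarith
  have hδ0 : (0 : ℚ) ≤ 3 * unitRoundoff p := by positivity
  have hδ1 : 3 * unitRoundoff p < 1 := by linarith
  have hmargin : (1 + 3 * unitRoundoff p) * (4 * unitRoundoff p + 18 * unitRoundoff p ^ 2
      + 34 * unitRoundoff p ^ 3 + 35 * unitRoundoff p ^ 4 + 21 * unitRoundoff p ^ 5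
      + 7 * unitRoundoff p ^ 6 + unitRoundoff p ^ 7)
      < (1 - unitRoundoff p) ^ 5 * iccerrboundB56 p :=
    iccerrboundB56_margin hu0 hu64
  -- grids: the six differences (`2^e₀ ℤ`) and their roundings, which are floats of `F(p, e₀)`
  have gta₁ := (OnGrid.of_isFloat ha₁).sub (OnGrid.of_isFloat hd₁)
  have gta₂ := (OnGrid.of_isFloat ha₂).sub (OnGrid.of_isFloat hd₂)
  have gtb₁ := (OnGrid.of_isFloat hb₁).sub (OnGrid.of_isFloat hd₁)
  have gtb₂ := (OnGrid.of_isFloat hb₂).sub (OnGrid.of_isFloat hd₂)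
  have gtc₁ := (OnGrid.of_isFloat hc₁).sub (OnGrid.of_isFloat hd₁)
  have gtc₂ := (OnGrid.of_isFloat hc₂).sub (OnGrid.of_isFloat hd₂)
  have gxa₁ := gta₁.fl_of hp1 hfl he₀
  have gxa₂ := gta₂.fl_of hp1 hfl he₀
  have gxb₁ := gtb₁.fl_of hp1 hfl he₀
  have gxb₂ := gtb₂.fl_of hp1 hfl he₀
  have gxc₁ := gtc₁.fl_of hp1 hfl he₀
  have gxc₂ := gtc₂.fl_of hp1 hfl he₀
  have fxa₁ : IsFloat p e₀ (fl (a₁ - d₁)) := isFloat_of_isFloat_of_onGrid (hfl _).1 gxa₁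
  have fxa₂ : IsFloat p e₀ (fl (a₂ - d₂)) := isFloat_of_isFloat_of_onGrid (hfl _).1 gxa₂
  have fxb₁ : IsFloat p e₀ (fl (b₁ - d₁)) := isFloat_of_isFloat_of_onGrid (hfl _).1 gxb₁
  have fxb₂ : IsFloat p e₀ (fl (b₂ - d₂)) := isFloat_of_isFloat_of_onGrid (hfl _).1 gxb₂
  have fxc₁ : IsFloat p e₀ (fl (c₁ - d₁)) := isFloat_of_isFloat_of_onGrid (hfl _).1 gxc₁
  have fxc₂ : IsFloat p e₀ (fl (c₂ - d₂)) := isFloat_of_isFloat_of_onGrid (hfl _).1 gxc₂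
  -- the six products, the six squares and their roundings (`2^2e₀ ℤ`)
  have gp₁ := gxb₁.mul gxc₂
  have gp₂ := gxc₁.mul gxb₂
  have gp₃ := gxc₁.mul gxa₂
  have gp₄ := gxa₁.mul gxc₂
  have gp₅ := gxa₁.mul gxb₂
  have gp₆ := gxb₁.mul gxa₂
  have gP₁ := gp₁.fl_of hp1 hfl he₂
  have gP₂ := gp₂.fl_of hp1 hfl he₂
  have gP₃ := gp₃.fl_of hp1 hfl he₂
  have gP₄ := gp₄.fl_of hp1 hfl he₂
  have gP₅ := gp₅.fl_of hp1 hfl he₂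
  have gP₆ := gp₆.fl_of hp1 hfl he₂
  have gsa₁ := gxa₁.mul gxa₁
  have gsa₂ := gxa₂.mul gxa₂
  have gsb₁ := gxb₁.mul gxb₁
  have gsb₂ := gxb₂.mul gxb₂
  have gsc₁ := gxc₁.mul gxc₁
  have gsc₂ := gxc₂.mul gxc₂
  have gSa₁ := gsa₁.fl_of hp1 hfl he₂
  have gSa₂ := gsa₂.fl_of hp1 hfl he₂
  have gSb₁ := gsb₁.fl_of hp1 hfl he₂
  have gSb₂ := gsb₂.fl_of hp1 hfl he₂
  have gSc₁ := gsc₁.fl_of hp1 hfl he₂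
  have gSc₂ := gsc₂.fl_of hp1 hfl he₂
  -- the lifts (`2^2e₀ ℤ`)
  have gla := gSa₁.add gSa₂
  have glb := gSb₁.add gSb₂
  have glc := gSc₁.add gSc₂
  have gLa := gla.fl_of hp1 hfl he₂
  have gLb := glb.fl_of hp1 hfl he₂
  have gLc := glc.fl_of hp1 hfl he₂
  -- the permanent chain: `A_a = fl(|P₁| + |P₂|)` (`2^2e₀ ℤ`), `α_a = fl(A_a · alift)`, `W₁`, `W`
  -- (`2^4e₀ ℤ`), `errbound = fl(K W)` (`2^(4e₀ − 2p) ℤ`)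
  have gsa := gP₁.abs.add gP₂.abs
  have gsb := gP₃.abs.add gP₄.abs
  have gsc := gP₅.abs.add gP₆.abs
  have gAa := gsa.fl_of hp1 hfl he₂
  have gAb := gsb.fl_of hp1 hfl he₂
  have gAc := gsc.fl_of hp1 hfl he₂
  have gala := gAa.mul gLa
  have galb := gAb.mul gLb
  have galc := gAc.mul gLc
  have gαa := gala.fl_of hp1 hfl he₄
  have gαb := galb.fl_of hp1 hfl he₄
  have gαc := galc.fl_of hp1 hfl he₄
  have gw₁ := gαa.add gαb
  have gW₁ := gw₁.fl_of hp1 hfl he₄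
  have gw := gW₁.add gαc
  have gW := gw.fl_of hp1 hfl he₄
  have ge := (onGrid_iccerrboundB56 p).mul gW
  -- signs of the computed squares and lifts
  have sSa₁ : 0 ≤ fl (fl (a₁ - d₁) * fl (a₁ - d₁)) := fl_nonneg hfl (mul_self_nonneg _)
  have sSa₂ : 0 ≤ fl (fl (a₂ - d₂) * fl (a₂ - d₂)) := fl_nonneg hfl (mul_self_nonneg _)
  have sSb₁ : 0 ≤ fl (fl (b₁ - d₁) * fl (b₁ - d₁)) := fl_nonneg hfl (mul_self_nonneg _)
  have sSb₂ : 0 ≤ fl (fl (b₂ - d₂) * fl (b₂ - d₂)) := fl_nonneg hfl (mul_self_nonneg _)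
  have sSc₁ : 0 ≤ fl (fl (c₁ - d₁) * fl (c₁ - d₁)) := fl_nonneg hfl (mul_self_nonneg _)
  have sSc₂ : 0 ≤ fl (fl (c₂ - d₂) * fl (c₂ - d₂)) := fl_nonneg hfl (mul_self_nonneg _)
  have sLa := fl_nonneg hfl (add_nonneg sSa₁ sSa₂)
  have sLb := fl_nonneg hfl (add_nonneg sSb₁ sSb₂)
  have sLc := fl_nonneg hfl (add_nonneg sSc₁ sSc₂)
  -- the expansion `fin1` is a W-expansion of floats with sum `B`; `det = estimate fin1 = B ± 3εB`
  obtain ⟨hW, hS, hF, -, -, -⟩ :=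
    incircleB_spec hp4 hfl hfl2 he₂ he₃ he₄' htp htp' htp'' fxa₁ fxa₂ fxb₁ fxb₂ fxc₁ fxc₂
  have hest := hest3 hF hW
  rw [hS] at hest
  unfold incircleDetB at hest
  -- the branches of stage B
  unfold incircleStageB at hB
  simp only [] at hB
  split_ifs at hB with htest
  obtain rfl := Option.some.inj hB
  simp only [incirclePermanent] at htest
  unfold incircleDet
  obtain ⟨⟨hBT₁, hBT₂⟩, ⟨hBd₁, hBd₂⟩⟩ := incircle_stageB_sign_of_bounds hu0 hu2 hδ0 hδ1 hmargin
    (abs_sub_fl_le_eps_mul_abs_fl hp1 hfl he₀ gta₁) (abs_sub_fl_le_eps_mul_abs_fl hp1 hfl he₀ gta₂)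
    (abs_sub_fl_le_eps_mul_abs_fl hp1 hfl he₀ gtb₁) (abs_sub_fl_le_eps_mul_abs_fl hp1 hfl he₀ gtb₂)
    (abs_sub_fl_le_eps_mul_abs_fl hp1 hfl he₀ gtc₁) (abs_sub_fl_le_eps_mul_abs_fl hp1 hfl he₀ gtc₂)
    (abs_sub_fl_le_eps_mul_abs_fl hp1 hfl he₂ gp₁) (abs_sub_fl_le_eps_mul_abs_fl hp1 hfl he₂ gp₂)
    (abs_sub_fl_le_eps_mul_abs_fl hp1 hfl he₂ gp₃) (abs_sub_fl_le_eps_mul_abs_fl hp1 hfl he₂ gp₄)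
    (abs_sub_fl_le_eps_mul_abs_fl hp1 hfl he₂ gp₅) (abs_sub_fl_le_eps_mul_abs_fl hp1 hfl he₂ gp₆)
    (abs_sub_fl_le_eps_mul_abs_fl hp1 hfl he₂ gsa₁) (abs_sub_fl_le_eps_mul_abs_fl hp1 hfl he₂ gsa₂)
    (abs_sub_fl_le_eps_mul_abs_fl hp1 hfl he₂ gsb₁) (abs_sub_fl_le_eps_mul_abs_fl hp1 hfl he₂ gsb₂)
    (abs_sub_fl_le_eps_mul_abs_fl hp1 hfl he₂ gsc₁) (abs_sub_fl_le_eps_mul_abs_fl hp1 hfl he₂ gsc₂)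
    sSa₁ sSa₂ sSb₁ sSb₂ sSc₁ sSc₂
    (abs_sub_fl_le_eps_mul_abs_fl hp1 hfl he₂ gla) (abs_sub_fl_le_eps_mul_abs_fl hp1 hfl he₂ glb)
    (abs_sub_fl_le_eps_mul_abs_fl hp1 hfl he₂ glc) sLa sLb sLc
    (abs_sub_fl_le_eps_mul_abs hp1 hfl he₂ gsa) (abs_sub_fl_le_eps_mul_abs hp1 hfl he₂ gsb)
    (abs_sub_fl_le_eps_mul_abs hp1 hfl he₂ gsc)
    (abs_sub_fl_le_eps_mul_abs hp1 hfl he₄ gala) (abs_sub_fl_le_eps_mul_abs hp1 hfl he₄ galb)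
    (abs_sub_fl_le_eps_mul_abs hp1 hfl he₄ galc)
    (abs_sub_fl_le_eps_mul_abs hp1 hfl he₄ gw₁) (abs_sub_fl_le_eps_mul_abs hp1 hfl he₄ gw)
    (abs_sub_fl_le_eps_mul_abs hp1 hfl he₅ ge) hest
    (htest.elim (fun h => le_trans h (le_abs_self _)) (fun h => le_trans h (neg_le_abs _)))
  exact ⟨hBd₁.symm.trans hBT₁, hBd₂.symm.trans hBT₂⟩

/-! ## Instances: FMA two-product; Dekker two-product -/

/-- **Stage B with the FMA two-product** (`2Prod_FMA`), given the `estimate` bound: sound for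
`p ≥ 6`, any `RoundoffBelow 2` round-to-nearest, coordinates in `F(p, e₀)` with `emin ≤ e₀`,
`emin + 2p ≤ 4e₀`. -/
theorem incircleStageB_fma_correct_of_estimate (hp : 6 ≤ p) (hfl : IsRoundNearest p emin fl)
    (hfl2 : RoundoffBelow 2 fl)
    (hest3 : ∀ ⦃l : List ℚ⦄, (∀ x ∈ l, IsFloat p emin x) → IsWeakExpansion l →
      |estimate fl l - l.sum| ≤ 3 * unitRoundoff p * |l.sum|)
    {e₀ : ℤ} (he₀ : emin ≤ e₀) (h4 : emin + 2 * p ≤ e₀ + e₀ + e₀ + e₀)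
    {a₁ a₂ b₁ b₂ c₁ c₂ d₁ d₂ : ℚ}
    (ha₁ : IsFloat p e₀ a₁) (ha₂ : IsFloat p e₀ a₂) (hb₁ : IsFloat p e₀ b₁)
    (hb₂ : IsFloat p e₀ b₂) (hc₁ : IsFloat p e₀ c₁) (hc₂ : IsFloat p e₀ c₂)
    (hd₁ : IsFloat p e₀ d₁) (hd₂ : IsFloat p e₀ d₂) {d : ℚ}
    (hB : incircleStageB (twoProdFMA fl) fl (iccerrboundB56 p)
      (incirclePermanent fl a₁ a₂ b₁ b₂ c₁ c₂ d₁ d₂) a₁ a₂ b₁ b₂ c₁ c₂ d₁ d₂ = some d) :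
    (0 < d ↔ 0 < incircleDet a₁ a₂ b₁ b₂ c₁ c₂ d₁ d₂) ∧
      (d < 0 ↔ incircleDet a₁ a₂ b₁ b₂ c₁ c₂ d₁ d₂ < 0) := by
  have hp1 : 1 ≤ p := le_trans (by norm_num) hp
  have he₂ : emin ≤ e₀ + e₀ := by omega
  have he₃ : emin ≤ e₀ + e₀ + e₀ := by omega
  have he₄ : emin ≤ e₀ + e₀ + e₀ + e₀ := by omega
  exact incircleStageB_correct_of_estimate hp hfl hfl2 hest3 he₀ h4 ha₁ ha₂ hb₁ hb₂ hc₁ hc₂ hd₁ hd₂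
    (fun x y hx hy => exactTwoProd_twoProdFMA₂ hp1 hfl he₂ hx hy)
    (fun x y hx hy => exactTwoProd_twoProdFMA₂ hp1 hfl he₃ hx hy)
    (fun x y hx hy => exactTwoProd_twoProdFMA₂ hp1 hfl he₄ hx hy) hB

/-- **Stage B with Shewchuk's TWO-PRODUCT** (Dekker, split point `s`, `p ≤ 2s ≤ p + 1`, rounding
odd and `RoundoffBelow 2` — ties-to-even qualifies), given the `estimate` bound: sound for `p ≥ 6`
and coordinates in `F(p, e₀)` with `e₀ ≥ emin + p − 1`, `2e₀ ≥ emin + 2p − 1` (Theorem 18's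
no-underflow regime for the two-products) and stage A's `4e₀ ≥ emin + 2p` (NOT a consequence of
the first two when `e₀ < 0`; together they give `3e₀, 4e₀ ≥ emin + 2p − 1`).  For binary64:
coordinates that are multiples of `2^−242`. -/
theorem incircleStageB_dekker_correct_of_estimate (hp : 6 ≤ p) {s : ℕ} (hs2 : p ≤ 2 * s)
    (hs2' : 2 * s ≤ p + 1) (hfl : IsRoundNearest p emin fl) (hodd : ∀ t, fl (-t) = -fl t)
    (hfl2 : RoundoffBelow 2 fl)
    (hest3 : ∀ ⦃l : List ℚ⦄, (∀ x ∈ l, IsFloat p emin x) → IsWeakExpansion l →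
      |estimate fl l - l.sum| ≤ 3 * unitRoundoff p * |l.sum|)
    {e₀ : ℤ} (h1 : emin + p - 1 ≤ e₀) (h2 : emin + 2 * p - 1 ≤ e₀ + e₀)
    (h4 : emin + 2 * p ≤ e₀ + e₀ + e₀ + e₀) {a₁ a₂ b₁ b₂ c₁ c₂ d₁ d₂ : ℚ}
    (ha₁ : IsFloat p e₀ a₁) (ha₂ : IsFloat p e₀ a₂) (hb₁ : IsFloat p e₀ b₁)
    (hb₂ : IsFloat p e₀ b₂) (hc₁ : IsFloat p e₀ c₁) (hc₂ : IsFloat p e₀ c₂)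
    (hd₁ : IsFloat p e₀ d₁) (hd₂ : IsFloat p e₀ d₂) {d : ℚ}
    (hB : incircleStageB (twoProduct fl s) fl (iccerrboundB56 p)
      (incirclePermanent fl a₁ a₂ b₁ b₂ c₁ c₂ d₁ d₂) a₁ a₂ b₁ b₂ c₁ c₂ d₁ d₂ = some d) :
    (0 < d ↔ 0 < incircleDet a₁ a₂ b₁ b₂ c₁ c₂ d₁ d₂) ∧
      (d < 0 ↔ incircleDet a₁ a₂ b₁ b₂ c₁ c₂ d₁ d₂ < 0) := by
  have hp4 : 4 ≤ p := le_trans (by norm_num) hp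
  have he₀ : emin ≤ e₀ := by omega
  exact incircleStageB_correct_of_estimate hp hfl hfl2 hest3 he₀ h4 ha₁ ha₂ hb₁ hb₂ hc₁ hc₂ hd₁ hd₂
    (fun x y hx hy => exactTwoProd_twoProduct₂ hp4 hs2 hs2' hfl hodd h1 h1 h2 hx hy)
    (fun x y hx hy => exactTwoProd_twoProduct₂ hp4 hs2 hs2' hfl hodd (by omega) h1 (by omega) hx hy)
    (fun x y hx hy => exactTwoProd_twoProduct₂ hp4 hs2 hs2' hfl hodd (by omega) h1 (by omega) hx hy)
    hB

/-- The inherited value is the one stage A computes: `incircleStageA` and `incircleStageB` read the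
same `permanent` (definitional). -/
theorem incircleStageA_eq (fl : ℚ → ℚ) (K : ℚ) (a₁ a₂ b₁ b₂ c₁ c₂ d₁ d₂ : ℚ) :
    incircleStageA fl K a₁ a₂ b₁ b₂ c₁ c₂ d₁ d₂ =
      (let det := fl (fl (fl (fl (fl (fl (a₁ - d₁) * fl (a₁ - d₁)) + fl (fl (a₂ - d₂)
          * fl (a₂ - d₂))) * fl (fl (fl (b₁ - d₁) * fl (c₂ - d₂)) - fl (fl (c₁ - d₁)
          * fl (b₂ - d₂)))) + fl (fl (fl (fl (b₁ - d₁) * fl (b₁ - d₁)) + fl (fl (b₂ - d₂)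
          * fl (b₂ - d₂))) * fl (fl (fl (c₁ - d₁) * fl (a₂ - d₂)) - fl (fl (a₁ - d₁)
          * fl (c₂ - d₂))))) + fl (fl (fl (fl (c₁ - d₁) * fl (c₁ - d₁)) + fl (fl (c₂ - d₂)
          * fl (c₂ - d₂))) * fl (fl (fl (a₁ - d₁) * fl (b₂ - d₂)) - fl (fl (b₁ - d₁)
          * fl (a₂ - d₂)))))
        let errbound := fl (K * incirclePermanent fl a₁ a₂ b₁ b₂ c₁ c₂ d₁ d₂)
        if errbound < det ∨ errbound < -det then some det else none) := rfl

end Summit.Ventures.CertifiedArithmetic.Expansions
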